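import Summits.QuantumAdvantage.QuantumAdvantage.Theorems.CharDialSubRank
import HarnessLib

/-!
# Junta ⊕ linear-form strategies over DISJOINTLY SUPPORTED pencils lose α's u-walk game — the DISJOINT-PENCIL DIAL, and
SPARSE ADAPTIVE PREFIX COUNTERS (SliceDial rev 15 annex, §29)

decomp-qadv lens-6 («barrier-complement carving») g13, tree part 21.  Prop-free, sorry-free.  IMPORTS part 19
`CharDialSubRank.lean` (§22 `Subcube.*` / `SubcubeBells.*` subcube transport `ringWinU_ext`, `junta_ext`, `linF_ext`, `merge_empty`,
`card_supp_res`; §23 the generalised block product `WindowCounter.exists_blocksG`, `norm_sum_QfG_le`, `formSumG`; §24 `formStratRG`,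
`card_win_formRG_eq_sum`, `class_count_le_formRG`, `genMain`, `log_le_sq_log`), hence the landed `Theorems.CharDialJLinPeel`
(`JLinData`, `winCount`), `CharDialSpreadRank(A)` (`comb`, `linF_comb`, `formStratR`), `CharDialFormJuntaB` (`linF`, `aExt`, `kappaF`,
`kappaF_lt_one`, …), `CharDialJLinSlice` (`sum_card_subcube`), and the tree rungs `AffBells22SubcubeWalk` (`subcubeMerge`, `emb`, `ext`,
`res`, `merge_eq_ext_res`) / `PredHard` (`DWalk.const_mul_logPow_le'`).  It does NOT import part 20 (`CharDialRankRate`): the two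
dials are independent.

WHAT IS NEW (the node's §29; in the node annex `SliceDial29.lean` these feed the typed faces `DisjPencilHard p`, `PrefixSepHard p`,
`PrefixSparseHard p` — PROVED — and the split `PrefixFormHard p ⟺ PrefixDenseHard p`).  Part 20's rate dial stops at rank
`≈ (n/log⁵ n)^{1/3}` because a GENERIC rank-`R` pencil has `p^R − 1` error terms, each needing its own blocks inside a free cube of
density `≳ 1/R`.  For a pencil of directions `V_1 … V_R` with PAIRWISE DISJOINT SUPPORTS the error sum FACTORISES IN TIME and
the number of directions never enters a threshold:
* `WindowCounter.exists_goodT` / `formJunta_blocksT` — the block product from a PRESCRIBED 3-separated set `T` of good starts of ONE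
  residue class mod 3: `2B·(2m(L+1)² + n) ≤ |T|²`, `t ≠ 0` ⟹ `‖Σ_u [WIN u] ψ_p(t⟨a,u⟩)‖ ≤ κ_F(p)^B·2ⁿ`; `arith_threeT`,
  `arith_blockTarget` (the ℕ bookkeeping: supports `≥ G` with `80·B·X ≤ G²` give the target);
* `WindowCounter.card_supp_comb_disj` — the support of `Σ_j t_j V_j` is the disjoint union of the ACTIVE supports;
  `sum_prod_ite_eq_pow`, `sum_pow_active_le` — `Σ_{t ≠ 0} x^{#active(t)} = (1 + (p−1)x)^R − 1 ≤ 2(p−1)R·x` once `(p−1)R·x ≤ 1/2`;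
* **`WindowCounter.form_reductionDisj`** — the generalised (`ringWinGen`, `m ≤ K·N` bells, `(log₂ N)²`-juntas) reduction for disjoint
  pencils: `∃ θ₁ < 1, ∀ K, ∃ E N₀, ∀ N ≥ N₀, ∀ R G, E·N·(log₂ N)⁵ ≤ G² →` supports `≥ G` ⟹ `#WIN(formStratRG V Y) ≤ θ₁·2^N`
  (`B₁ = q₁(ℓ+4)` blocks per active direction make `κ^{B₁} ≤ ε/(2(p−1)N)`, and `R ≤ N` is automatic);
* `JLinPeel.disj_denseD` — transport to a coordinate subcube `(W, β)` with `2|W| ≤ n` (the tree's §22), `disjPencil_hard` (tables,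
  `W = ∅`), **`disjPencil_hard_unif`** (data level: `∃ θ < 1, ∃ E n₀, ∀ n ≥ n₀, ∀ R G, E·n·(log₂ n)⁵ ≤ G² → ∀ c (D : JLinData p n),`
  `log₂ n`-juntas, non-blind forms in the span of a disjoint pencil with supports `≥ G` ⟹ `winCount ≤ θ·2ⁿ`);
* `JLinPeel.strat_eq_formStratR_on` (re-presentation on a subcube: the `W`-parts of the forms are constants absorbed by the tables),
  `disjPencil_sub_unif` (subcube data level, supports counted OFF `W`), `disjPencil_sub_dich` (directions vanishing off `W` pruned);
* PREFIX COUNTERS (`D.a g = t_g·𝟙_{[0,g)}`): `cutRank`, `gapLo`, `cutRank_eq_iff`, `card_cutRank_eq` (the rank classes of the set `S`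
  of non-blind cuts are the gaps between consecutive elements of `S`), `prefix_mem_rankSpan` (every prefix form of a cut in `S` is a
  combination of the class indicators — a disjoint pencil), **`prefixSep_hard_unif`** (non-blind cuts pairwise `≥ G` apart and `≥ G`
  from the start lose) and, freezing the short gaps into `W` (`|W| ≤ G·#S ≤ n/2`) and counting fibres (`sum_card_subcube`),
  **`prefixSparse_hard_unif`**: `2·G·#{non-blind cuts} ≤ n`, `E·n·(log₂ n)⁵ ≤ G²` ⟹ `winCount ≤ θ·2ⁿ` — ANY placement of up to
  `n/(2G) ≈ √n/(2√E·(log₂ n)^{5/2})` adaptive MOD-`p` prefix counters (each also reading a `log₂ n`-junta) loses, for every prime `p ≥ 5`.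
What is NOT reached: the time-dense prefix regime (more than `n/(2G)` non-blind cuts; the node's `PrefixDenseHard p`), rank above
`√n/polylog` for disjoint pencils with short supports, and generic (non-disjoint) pencils above the cube-root rate (part 20).
-/

noncomputable section

open Finset
open Summit.QuantumAdvantage.AdviceFreeQNC0 Summit.QuantumAdvantage.AdviceFreeQNC0.JLinPeel

/-! # §29 THE DISJOINT-PENCIL DIAL (decomp-qadv lens-6 g13 rev 15): a TIME-FACTORISED error sum — junta ⊕ form data whose
non-blind forms lie in a pencil spanned by DISJOINTLY SUPPORTED directions, each of support `≥ √(E·n)·(log₂ n)^{5/2}`, lose;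
no rank hypothesis (rank up to `√n/polylog`, ABOVE the cube-root ceiling of the generic slicing engine §27).

* `formJunta_blocksT` — the block product from a PRESCRIBED 3-separated set `T` of good starts: `2B(2m(L+1)²+n) ≤ |T|²` ⟹
  bias `≤ κ_F^B·2ⁿ` (second half of `formJunta_blocksG`);
* `card_supp_comb_disj` — for a disjointly supported pencil the support of `Σ_j t_j V_j` is the disjoint union of the active supports;
* `sum_pow_active_le` — `Σ_{t ≠ 0} x^{#active(t)} = (1 + (p−1)x)^R − 1 ≤ 2(p−1)R·x` (the product formula);
* `form_reductionDisj` — the generalised reduction for disjoint pencils: `E·N·(log₂N)⁵ ≤ G²`, supports `≥ G` ⟹ `#WIN ≤ θ₁2^N`;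
* `disj_denseD` (subcube transport, §22) and the corollaries `disjPencil_hard` (tables), `disjPencil_hard_unif` (data). -/

namespace Summit.QuantumAdvantage.AdviceFreeQNC0.WindowCounter

open Summit.QuantumAdvantage.AdviceFreeQNC0 AffBells23

section DisjointPencil

variable (p : ℕ) [Fact p.Prime]

/-- good block starts for a direction `a`: a 3-separated set `T` of positions `k` with `k+3 ≤ n`, `a_k ≠ 0`, and
`#supp a ≤ 3|T| + 4` (one residue class mod 3 of the good positions). -/
theorem exists_goodT {n : ℕ} (a : Fin n → ZMod p) :
    ∃ T : Finset ℕ, (∀ k ∈ T, k + 3 ≤ n) ∧ (∀ k ∈ T, aExt p a k ≠ 0) ∧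
      (∀ k ∈ T, ∀ k' ∈ T, k ≠ k' → k + 3 ≤ k' ∨ k' + 3 ≤ k) ∧ T.card ≤ n ∧
      (univ.filter fun i : Fin n => a i ≠ 0).card ≤ 3 * T.card + 4 := by
  classical
  set S₀ : Finset ℕ := (range n).filter fun k => k + 3 ≤ n ∧ aExt p a k ≠ 0 with hS₀
  have hS₀card : (univ.filter fun i : Fin n => a i ≠ 0).card ≤ S₀.card + 2 := by
    have h1 : ((univ.filter fun i : Fin n => a i ≠ 0 ∧ i.val + 3 ≤ n).image fun i : Fin n => i.val) ⊆ S₀ := by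
      intro k hk; rw [mem_image] at hk; obtain ⟨i, hi, rfl⟩ := hk; rw [mem_filter] at hi
      rw [hS₀, mem_filter, mem_range]; refine ⟨i.isLt, hi.2.2, ?_⟩
      unfold aExt; rw [dif_pos i.isLt]; exact hi.2.1
    have h2 : (univ.filter fun i : Fin n => ¬ (i.val + 3 ≤ n)).card ≤ 2 := by
      calc _ ≤ (range 2).card := Finset.card_le_card_of_injOn (fun i : Fin n => n - 1 - i.val) (fun i hi => by
              have hi' : ¬ (i.val + 3 ≤ n) := by simpa using hi
              simp only [mem_coe, mem_range]; omega) (by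
              intro i hi i' hi' hh
              have h3 : ¬ (i.val + 3 ≤ n) := by simpa using hi
              have h4 : ¬ (i'.val + 3 ≤ n) := by simpa using hi'
              ext; simp only at hh; omega)
        _ = 2 := card_range 2
    have h3 := card_le_card h1
    rw [card_image_of_injective _ Fin.val_injective] at h3
    calc (univ.filter fun i : Fin n => a i ≠ 0).card
        ≤ ((univ.filter fun i : Fin n => a i ≠ 0 ∧ i.val + 3 ≤ n) ∪ (univ.filter fun i : Fin n => ¬ (i.val + 3 ≤ n))).card :=
          card_le_card (by
            intro i hi; rw [mem_filter] at hi; rw [mem_union, mem_filter, mem_filter]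
            by_cases h : i.val + 3 ≤ n
            · exact Or.inl ⟨hi.1, hi.2, h⟩
            · exact Or.inr ⟨hi.1, h⟩)
      _ ≤ _ := card_union_le _ _
      _ ≤ S₀.card + 2 := add_le_add h3 h2
  obtain ⟨r, -, hr⟩ := Finset.exists_le_card_fiber_of_mul_le_card_of_maps_to (s := S₀) (t := range 3) (f := fun k => k % 3)
    (fun k _ => mem_range.2 (Nat.mod_lt _ (by norm_num))) (by simp) (by rw [card_range]; exact Nat.mul_div_le _ 3)
  set T := S₀.filter fun k => k % 3 = r with hTdef
  have hT3 : S₀.card ≤ 3 * T.card + 2 := by have := hr; omega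
  refine ⟨T, fun k hk => ?_, fun k hk => ?_, fun k hk k' hk' hne => ?_, ?_, by omega⟩
  · have := (mem_filter.1 (mem_filter.1 hk).1).2; exact this.1
  · have := (mem_filter.1 (mem_filter.1 hk).1).2; exact this.2
  · have h1 := (mem_filter.1 hk).2; have h2 := (mem_filter.1 hk').2; omega
  · exact (card_le_card (filter_subset _ _)).trans ((card_le_card (filter_subset _ _)).trans (card_range n).le)

/-- **THE BLOCK PRODUCT FROM A PRESCRIBED SET OF GOOD STARTS** (`p ≥ 5`): `m` generalised bells, `L`-junta tables, a
3-separated set `T` of good starts of the direction `a` with `2B·(2m(L+1)² + n) ≤ |T|²` ⟹ `‖Σ_u [WIN u] ψ_p(t⟨a,u⟩)‖ ≤ κ_F(p)^B·2ⁿ`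
(Turán selection `exists_blocksG` + `norm_sum_QfG_le`). -/
theorem formJunta_blocksT (hp : 5 ≤ p) (B : ℕ) {n m L : ℕ} (pat κ : Fin m → ℕ)
    (a : Fin n → ZMod p) (y : Fin m → (Fin n → Bool) → Bool)
    (hy : ∀ b, ∃ J : Finset (Fin n), J.card ≤ L ∧ ∀ u v : Fin n → Bool, (∀ i ∈ J, u i = v i) → y b u = y b v)
    (T : Finset ℕ) (hTn : ∀ k ∈ T, k + 3 ≤ n) (hTgd : ∀ k ∈ T, aExt p a k ≠ 0)
    (hTsep : ∀ k ∈ T, ∀ k' ∈ T, k ≠ k' → k + 3 ≤ k' ∨ k' + 3 ≤ k) (hTle : T.card ≤ n) (hn : 0 < n)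
    (hB : 2 * B * (2 * (m * (L + 1) ^ 2) + n) ≤ T.card ^ 2) (t : ZMod p) (ht : t ≠ 0) :
    ‖formSumG p pat κ a y t‖ ≤ kappaF p ^ B * 2 ^ n := by
  classical
  have hκ0 := kappaF_nonneg p
  have hκ1 := kappaF_lt_one p hp
  choose J hJc hJ using hy
  obtain ⟨M, k, hkT, hkinj, hni, hsize⟩ := exists_blocksG pat J hJc T hTsep
  -- enough blocks: `B ≤ M`
  have hM : B ≤ M := by
    have h1 : T.card ^ 2 ≤ 2 * M * (2 * (m * (L + 1) ^ 2) + n) :=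
      hsize.trans (Nat.mul_le_mul_left _ (Nat.add_le_add_left hTle _))
    have h2 : B * (2 * (2 * (m * (L + 1) ^ 2) + n)) ≤ M * (2 * (2 * (m * (L + 1) ^ 2) + n)) :=
      calc B * (2 * (2 * (m * (L + 1) ^ 2) + n)) = 2 * B * (2 * (m * (L + 1) ^ 2) + n) := by ring
        _ ≤ 2 * M * (2 * (m * (L + 1) ^ 2) + n) := hB.trans h1
        _ = M * (2 * (2 * (m * (L + 1) ^ 2) + n)) := by ring
    exact Nat.le_of_mul_le_mul_right h2 (by omega)
  -- the two character sums (verbatim from `formJunta_blocksG`)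
  have hkn : ∀ j, k j + 3 ≤ n := fun j => hTn _ (hkT j)
  have hksep : ∀ j j', j ≠ j' → k j + 3 ≤ k j' ∨ k j' + 3 ≤ k j := fun j j' h => hTsep _ (hkT j) _ (hkT j') (hkinj j j' h)
  have hkgd : ∀ j, aExt p a (k j) ≠ 0 := fun j => hTgd _ (hkT j)
  have hQ1 := norm_sum_QfG_le p pat κ y J hp hJ a ht M k hkn hksep hni hkgd
  have hQ0 := norm_sum_QfG_le p pat κ (fun _ _ => false) J hp (fun _ _ _ _ => rfl) a ht M k hkn hksep hni hkgd
  have hplain : ∑ u, QfG p pat κ (fun _ _ => false) a t u = ∑ u : Fin n → Bool, (ZMod.stdAddChar (t * linF p a u) : ℂ) :=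
    sum_congr rfl fun u _ => by simp [QfG, firesG]
  rw [hplain] at hQ0
  have e : ∀ u : Fin n → Bool, (if ringWinGen pat κ y u = true then (1 : ℂ) else 0) * (ZMod.stdAddChar (t * linF p a u) : ℂ) =
      ((ZMod.stdAddChar (t * linF p a u) : ℂ) - QfG p pat κ y a t u) / 2 := fun u => by
    rw [win_indicatorG]; unfold QfG; ring
  have hform : formSumG p pat κ a y t =
      ((∑ u : Fin n → Bool, (ZMod.stdAddChar (t * linF p a u) : ℂ)) - ∑ u, QfG p pat κ y a t u) / 2 := by
    unfold formSumG; rw [sum_congr rfl fun u _ => e u, ← sum_div, sum_sub_distrib]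
  have hκM : kappaF p ^ M ≤ kappaF p ^ B := pow_le_pow_of_le_one hκ0 hκ1.le hM
  have h2 : ‖(2 : ℂ)‖ = 2 := by simp
  have h2n : (0 : ℝ) ≤ 2 ^ n := by positivity
  rw [hform, norm_div, h2]
  calc _ ≤ (‖∑ u : Fin n → Bool, (ZMod.stdAddChar (t * linF p a u) : ℂ)‖ + ‖∑ u, QfG p pat κ y a t u‖) / 2 := by
        gcongr; exact norm_sub_le _ _
    _ ≤ (2 ^ n * kappaF p ^ M + 2 ^ n * kappaF p ^ M) / 2 := by gcongr
    _ = 2 ^ n * kappaF p ^ M := by ring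
    _ ≤ 2 ^ n * kappaF p ^ B := mul_le_mul_of_nonneg_left hκM h2n
    _ = kappaF p ^ B * 2 ^ n := mul_comm _ _

/-- for a pencil with pairwise DISJOINT supports, the support of `Σ_j t_j V_j` is the disjoint union of the supports of
the ACTIVE directions (`t_j ≠ 0`). -/
theorem card_supp_comb_disj {R n : ℕ} (V : Fin R → Fin n → ZMod p)
    (hdisj : ∀ j j', j ≠ j' → ∀ i, V j i = 0 ∨ V j' i = 0) (t : Fin R → ZMod p) :
    (univ.filter fun i : Fin n => comb p t V i ≠ 0).card =
      ∑ j ∈ univ.filter (fun j : Fin R => t j ≠ 0), (univ.filter fun i : Fin n => V j i ≠ 0).card := by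
  classical
  have key : ∀ i j, V j i ≠ 0 → comb p t V i = t j * V j i := fun i j hj => by
    unfold comb
    rw [Finset.sum_eq_single j (fun j' _ hne => ?_) (fun h => (h (mem_univ j)).elim)]
    rcases hdisj j' j hne i with h | h
    · rw [h, mul_zero]
    · exact (hj h).elim
  have hzero : ∀ i, (∀ j, V j i = 0) → comb p t V i = 0 := fun i h => by
    unfold comb; exact Finset.sum_eq_zero fun j _ => by rw [h j, mul_zero]
  have hset : (univ.filter fun i : Fin n => comb p t V i ≠ 0) =
      (univ.filter fun j : Fin R => t j ≠ 0).biUnion fun j => univ.filter fun i : Fin n => V j i ≠ 0 := by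
    ext i
    simp only [mem_filter, mem_univ, true_and, mem_biUnion]
    constructor
    · intro hi
      by_cases hex : ∃ j, V j i ≠ 0
      · obtain ⟨j, hj⟩ := hex
        refine ⟨j, fun htj => ?_, hj⟩
        rw [key i j hj, htj, zero_mul] at hi; exact hi rfl
      · push Not at hex; exact (hi (hzero i hex)).elim
    · rintro ⟨j, htj, hj⟩
      rw [key i j hj]; exact mul_ne_zero htj hj
  rw [hset, card_biUnion]
  intro j _ j' _ hne
  rw [Function.onFun, Finset.disjoint_filter]
  intro i _ h1 h2
  rcases hdisj j j' hne i with h | h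
  · exact h1 h
  · exact h2 h

/-- the product formula: `Σ_{t : (ℤ/p)^R} Π_j [t_j = 0 ? 1 : x] = (1 + (p−1)·x)^R`. -/
theorem sum_prod_ite_eq_pow {R : ℕ} (x : ℝ) :
    ∑ t : Fin R → ZMod p, ∏ j, (if t j = 0 then (1 : ℝ) else x) = (1 + ((p : ℝ) - 1) * x) ^ R := by
  classical
  have hp1 : 1 ≤ p := (Fact.out : p.Prime).one_lt.le
  have h := Finset.prod_univ_sum (fun _ : Fin R => (univ : Finset (ZMod p))) (fun _ s => if s = 0 then (1 : ℝ) else x)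
  rw [Fintype.piFinset_univ] at h
  rw [← h, prod_const, card_univ, Fintype.card_fin]
  congr 1
  rw [Finset.sum_ite, sum_const, sum_const, nsmul_eq_mul, nsmul_eq_mul, mul_one]
  have e1 : (univ.filter fun s : ZMod p => s = 0).card = 1 := by
    rw [Finset.filter_eq' univ (0 : ZMod p), if_pos (mem_univ _), card_singleton]
  have e2 : (univ.filter fun s : ZMod p => ¬ s = 0).card = p - 1 := by
    have := Finset.card_filter_add_card_filter_not (s := (univ : Finset (ZMod p))) (fun s => s = 0)
    rw [e1, card_univ, ZMod.card] at this; omega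
  rw [e1, e2, Nat.cast_one, Nat.cast_sub hp1, Nat.cast_one]

/-- **the time-factorised error sum**: `Σ_{t ≠ 0} x^{#active(t)} ≤ 2·(p−1)·R·x` once `(p−1)·R·x ≤ 1/2` (`0 ≤ x`). -/
theorem sum_pow_active_le {R : ℕ} {x : ℝ} (hx0 : 0 ≤ x) (hR : ((p : ℝ) - 1) * R * x ≤ 1 / 2) :
    ∑ t ∈ univ.erase (0 : Fin R → ZMod p), x ^ (univ.filter fun j : Fin R => t j ≠ 0).card ≤
      2 * (((p : ℝ) - 1) * R * x) := by
  classical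
  have hp1 : (1 : ℝ) ≤ p := by exact_mod_cast (Fact.out : p.Prime).one_lt.le
  have e : ∀ t : Fin R → ZMod p, x ^ (univ.filter fun j : Fin R => t j ≠ 0).card =
      ∏ j, (if t j = 0 then (1 : ℝ) else x) := fun t => by
    rw [Finset.prod_ite, prod_const_one, one_mul, prod_const]
  have htot := sum_prod_ite_eq_pow p (R := R) x
  have h0 : ∏ j, (if (0 : Fin R → ZMod p) j = 0 then (1 : ℝ) else x) = 1 := by simp
  have hsplit := Finset.sum_erase_add (univ : Finset (Fin R → ZMod p))
    (fun t => ∏ j, (if t j = 0 then (1 : ℝ) else x)) (mem_univ 0)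
  rw [htot, h0] at hsplit
  set y : ℝ := ((p : ℝ) - 1) * x with hy
  have hy0 : 0 ≤ y := mul_nonneg (by linarith) hx0
  have hRy0 : 0 ≤ (R : ℝ) * y := by positivity
  have hRy : (R : ℝ) * y ≤ 1 / 2 := by rw [hy]; nlinarith
  have h1 : (1 + y) ^ R ≤ Real.exp ((R : ℝ) * y) := by
    calc (1 + y) ^ R ≤ (Real.exp y) ^ R :=
          pow_le_pow_left₀ (by linarith) (by linarith [Real.add_one_le_exp y]) R
      _ = Real.exp ((R : ℝ) * y) := by rw [← Real.exp_nat_mul]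
  have h2 : Real.exp ((R : ℝ) * y) - 1 ≤ 2 * ((R : ℝ) * y) := by
    have hab : |(R : ℝ) * y| ≤ 1 := by rw [abs_of_nonneg hRy0]; linarith
    have := Real.abs_exp_sub_one_le hab
    rw [abs_of_nonneg hRy0] at this
    exact (le_abs_self _).trans this
  calc ∑ t ∈ univ.erase (0 : Fin R → ZMod p), x ^ (univ.filter fun j : Fin R => t j ≠ 0).card
      = ∑ t ∈ univ.erase (0 : Fin R → ZMod p), ∏ j, (if t j = 0 then (1 : ℝ) else x) := sum_congr rfl fun t _ => e t
    _ = (1 + y) ^ R - 1 := by linarith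
    _ ≤ 2 * ((R : ℝ) * y) := by linarith
    _ = 2 * (((p : ℝ) - 1) * R * x) := by rw [hy]; ring


end DisjointPencil
end Summit.QuantumAdvantage.AdviceFreeQNC0.WindowCounter
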